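import Literature.AlgebraicGeometry.HodgeTheory.HolomorphicBundleChernCharacterTopDegree
import Literature.AlgebraicGeometry.HodgeTheory.ChernCharacterClass
import Literature.AlgebraicGeometry.HodgeTheory.HodgeTypePullbackVanishing
import Literature.AlgebraicGeometry.HodgeTheory.HyperplaneClassHardLefschetzPullback
import Literature.Geometry.Kaehler.ChernCharacterPullback
import HarnessLib

/-!
# Functoriality of `ch₁(𝒪(-1))` along an arbitrary morphism `ψ : T ⟶ ℙᴺ`, across Hodge models

Family `hodge`, layer `Literature/AlgebraicGeometry/HodgeTheory`. Let `T` be a smooth projective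
complex `n`-fold with a Hodge model `A`, let `B` be a Hodge model of `ℙᴺ` (`n ≤ N`), and let
`V = 𝒪(-1)` be the tautological line cocycle of `ℙᴺ` read on `B` (`Motives.AnalytificationKaehler.
tautologicalBundle (𝟙 ℙᴺ) B.isAnalytification`, transition functions `xᵢ/xⱼ`). For every morphism
`ψ : T ⟶ ℙᴺ` the analytic map `ψ^an : A.carrier → B.carrier` (`HodgeModel.anMap B A ψ`, real `C^∞`
by Serre's GAGA, `HodgeModel.contMDiff_anMap`) induces the cocycle `(ψ^an)⁻¹V` on `A`
(`SmoothComplexVectorBundle.pullback`), and Kobayashi's naturality axiom of the Chern character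
(Ch. II §1, Axiom 2: "`c(f⁻¹E) = f^*(c(E))`", proved in the tree at the de Rham level as
`SmoothComplexVectorBundle.chernCharacterDeRham_pullback`) becomes, for the classes
`HodgeModel.chernCharacter` in `H²(–(ℂ); ℂ)` (Kobayashi II Thm. 2.16, file `ChernCharacterClass`):

* `HodgeModel.exists_chernCharacter_tautologicalBundle_pullback_eq_smul_map` — **there is ONE
  non-zero scalar `r ∈ ℂ`, depending on `(T, A, N, B)` but not on `ψ`, with
  `ch₁ᴬ((ψ^an)⁻¹V) = r • ψ^* ch₁ᴮ(V)` for every `ψ : T ⟶ ℙᴺ`.**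

Why a scalar: `A.chernCharacter` is normalised through `A`'s own de Rham comparison family
`A.deRham` (over `A.model`-manifolds), `B.chernCharacter` through `B.deRham` (over
`B.model`-manifolds). The class `ψ^* ch₁ᴮ(V)` is transported EXACTLY to `A.carrier` through the
cylinder construction of `HodgeTypePullback` (`HodgeModel.inducedIso B A hnN`, naturality of
`B.deRham` along `ψ^an ∘ π : Cyl(A.carrier) → B.carrier`, `HodgeModel.map_anMap_pullback`):
`A^*(ψ^* ch₁ᴮ(V)) = e''((ψ^an)^*_dR ch₁(V))` with `e'' = inducedIso B A hnN A.carrier 2`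
(`HodgeModel.pullback_map_chernCharacter_eq_inducedIso`), while
`A^*(ch₁ᴬ((ψ^an)⁻¹V)) = A.deRham((ψ^an)^*_dR ch₁(V))` (`HodgeModel.pullback_chernCharacter_eq` and
the de Rham naturality). The two natural comparison families `A.deRham` and `e''` over
`A.model`-manifolds agree on the compact manifold `A.carrier` up to a scalar in each degree
(`NaturalDeRhamComparisonRigidity_holds`), and the scalar may be taken non-zero
(`HodgeModel.exists_ne_zero_deRham_eq_smul_inducedIso`: both families are isomorphisms, and on the
zero space any scalar works). The pull-back `A^*` being injective, the identity follows with this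
`r`, uniformly in `ψ`.

Everything is proved; no definition and no named fact is introduced.

## References

* [Kobayashi1987] S. Kobayashi, *Differential Geometry of Complex Vector Bundles* (1987), Ch. I §1
  (1.20)–(1.21); Ch. II §1 Axiom 2, §2 Thm. 2.16 and (2.20)–(2.21).
* [VoisinHodgeI2002] C. Voisin, *Hodge Theory and Complex Algebraic Geometry I* (CUP 2002), §7.3.2
  (functoriality of `φ^*`), §11.2 (Chern classes), Thm. 11.32.
* [SerreGAGA1956] J.-P. Serre, *Géométrie algébrique et géométrie analytique*, Ann. Inst. Fourier 6
  (1956), §2 n°5, n°7 Prop. 6.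
* [Milnor1963] J. Milnor, *Morse Theory* (1963), §3, §5 (rigidity of natural comparisons, through
  `NaturalDeRhamComparisonRigidity_holds`).
-/

noncomputable section

open scoped Manifold ContDiff
open CategoryTheory AlgebraicGeometry

namespace Literature.AlgebraicGeometry.HodgeTheory

section HodgeTheory

open Literature.AlgebraicGeometry Literature.Geometry.Kaehler Literature.AlgebraicTopology.SingularHomology
open Literature.NumberTheory.Transcendental (complexDeRhamCohomology)
open Literature.AlgebraicGeometry.Motives (projectiveSpace IsSmoothProjective)

variable {n m : ℕ} {T Y : Motives.SchemeOver ℂ}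

namespace HodgeModel

/-- `T^an` is compact for `T` smooth projective (`T` proper over `ℂ`, `T(ℂ)` compact, and
`T^an ≃ₜ T(ℂ)`). Local copy of `HodgeModel.compactSpace_carrier`. [cite: SerreGAGA1956, §2 n°7 Prop. 6] -/
private theorem compactSpace_carrier₂ (A : HodgeModel n T) (hT : IsSmoothProjective n T) :
    CompactSpace A.carrier := by
  haveI : IsProper T.hom := Motives.IsSmoothProjective.isProper_holds hT
  haveI : CompactSpace (Motives.ComplexPoints T) := Motives.compactSpace_algPoints_of_isProper_holds T ℂ
  exact A.isAnalytification.homeomorph.symm.compactSpace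

/-- **The comparison of `A` and the comparison induced from `B` differ by a NON-ZERO scalar.** For a
smooth projective `n`-fold `T` with Hodge model `A` and a Hodge model `B` of any `Y` of dimension
`m ≥ n`, in each degree `k` there is `r ≠ 0` with `A.deRham = r • e''` on `Hᵏ_dR(T^an; ℂ)`, where
`e'' = inducedIso B A hnm A.carrier k` is the comparison over `A.model`-manifolds induced from
`B.deRham` through the cylinder `Cyl(A.carrier)` (`HodgeTypePullback`). Rigidity of natural de Rham
comparisons on the compact manifold `T^an` (`NaturalDeRhamComparisonRigidity_holds`, applied to the
natural families `inducedFamily B A hnm` and `A.deRham` and the identity diffeomorphism) gives a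
scalar `s`; if `s = 0` then `A.deRham`, an isomorphism, vanishes, so `Hᵏ_dR(T^an; ℂ) = 0` and `r = 1`
works. [cite: Milnor1963, Thm. 3.5 and §5] [cite: VoisinHodgeI2002, §7.3.2] -/
theorem exists_ne_zero_deRham_eq_smul_inducedIso (hT : IsSmoothProjective n T) (A : HodgeModel n T)
    (B : HodgeModel m Y) (hnm : n ≤ m) (k : ℕ) :
    ∃ r : ℂ, r ≠ 0 ∧ ∀ y : complexDeRhamCohomology A.model A.carrier k,
      A.deRham A.carrier k y = r • inducedIso B A hnm A.carrier k y := by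
  haveI : CompactSpace A.carrier := compactSpace_carrier₂ A hT
  obtain ⟨s, hs⟩ := NaturalDeRhamComparisonRigidity_holds A.model A.model (inducedFamily B A hnm)
    (isNatural_inducedFamily B A hnm) A.deRham A.deRham_isNatural A.carrier A.carrier
    (Homeomorph.refl A.carrier) contMDiff_id contMDiff_id k
  have hs' : ∀ y : complexDeRhamCohomology A.model A.carrier k,
      A.deRham A.carrier k y = s • inducedIso B A hnm A.carrier k y := by
    intro y
    have h := hs y
    have hid : (⟨Homeomorph.refl A.carrier, (Homeomorph.refl A.carrier).continuous⟩ :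
        C(A.carrier, A.carrier)) = ContinuousMap.id A.carrier := rfl
    rw [hid, singularCohomology.map_id] at h
    change A.deRham A.carrier k y =
      s • inducedIso B A hnm A.carrier k (complexDeRhamCohomology.map A.model contMDiff_id k y) at h
    rwa [complexDeRhamCohomology.map_id, LinearMap.id_apply] at h
  by_cases hs0 : s = 0
  · -- degenerate case: `A.deRham = 0` on `Hᵏ_dR`, an isomorphism, so `Hᵏ_dR(T^an; ℂ) = 0`
    refine ⟨1, one_ne_zero, fun y ↦ ?_⟩
    have hy : y = 0 :=
      (A.deRham A.carrier k).injective (by rw [hs', hs0, zero_smul, map_zero])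
    rw [hy, map_zero, map_zero, smul_zero]
  · exact ⟨s, hs0, hs'⟩

/-- **Transport of `ψ^* ch_p(V)` to `T^an` through the cylinder.** For Hodge models `A` of `T`
(dimension `n`) and `B` of `Y` (dimension `m ≥ n`), a morphism `ψ : T ⟶ Y` with `ψ^an` real `C^∞`,
and a cocycle `V` on `B`: `A^*(ψ^* ch_p(V)) = e''((ψ^an)^*_dR ch_p(V))`, `e'' = inducedIso B A hnm`
— `B^* ch_p(V) = B.deRham(ch_p(V))` (`pullback_chernCharacter_eq`), naturality of `B.deRham` along
`ψ^an ∘ π : Cyl(A.carrier) → B.carrier`, `(ψ^an)^* ∘ B^* = A^* ∘ ψ^*` (`map_anMap_pullback`) and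
`π ∘ i = id`. [cite: VoisinHodgeI2002, §7.3.2] [cite: Kobayashi1987, Ch. II §2 Thm. 2.16] -/
theorem pullback_map_chernCharacter_eq_inducedIso (A : HodgeModel n T) (B : HodgeModel m Y)
    (hnm : n ≤ m) (ψ : T ⟶ Y) (hf : ContMDiff 𝓘(ℝ, A.model) 𝓘(ℝ, B.model) ∞ (anMap B A ψ))
    {ι : Type} {r : ℕ} (V : SmoothComplexVectorBundle ι B.model B.carrier r) (p : ℕ) :
    A.pullback (2 * p) (complexBetti.map ψ (2 * p) (B.chernCharacter V p)) =
      inducedIso B A hnm A.carrier (2 * p)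
        (complexDeRhamCohomology.map A.model hf (2 * p) (V.chernCharacterDeRham p)) := by
  rw [inducedIso_apply, ← LinearMap.comp_apply (g := complexDeRhamCohomology.map A.model hf (2 * p)),
    ← complexDeRhamCohomology.map_comp hf (contMDiff_cylFst B A hnm A.carrier),
    B.deRham_isNatural (Cyl B A hnm A.carrier) B.carrier _ (hf.comp (contMDiff_cylFst B A hnm A.carrier))
      (2 * p) (V.chernCharacterDeRham p),
    ← B.pullback_chernCharacter_eq, ← map_anMap_pullback]
  change _ = ((singularCohomology.map ℂ ℂ _ (2 * p) ≫ singularCohomology.map ℂ ℂ _ (2 * p)).hom _)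
  rw [← singularCohomology.map_comp]
  rfl

/-- **`ch_p` of an induced cocycle, across Hodge models, up to the rigidity scalar.** With `r` as in
`exists_ne_zero_deRham_eq_smul_inducedIso` (`A.deRham = r • e''` in degree `2p`), for every morphism
`ψ : T ⟶ Y` of smooth projective varieties and every cocycle `V` on `B` carrying a connection:
`ch_pᴬ((ψ^an)⁻¹V) = r • ψ^* ch_pᴮ(V)` — Kobayashi's naturality `ch_p(f⁻¹V) = f^*_dR ch_p(V)`
(`chernCharacterDeRham_pullback`), `A^* ch_pᴬ = A.deRham(ch_p)` (`pullback_chernCharacter_eq`), the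
transport `pullback_map_chernCharacter_eq_inducedIso`, and injectivity of `A^*`.
[cite: Kobayashi1987, Ch. II §1 Axiom 2 and §2 Thm. 2.16] [cite: VoisinHodgeI2002, §7.3.2] -/
theorem chernCharacter_pullback_eq_smul_map_of_deRham_eq_smul (A : HodgeModel n T) (B : HodgeModel m Y)
    (hnm : n ≤ m) {p : ℕ} {r : ℂ}
    (hr : ∀ y : complexDeRhamCohomology A.model A.carrier (2 * p),
      A.deRham A.carrier (2 * p) y = r • inducedIso B A hnm A.carrier (2 * p) y)
    (ψ : T ⟶ Y) (hf : ContMDiff 𝓘(ℝ, A.model) 𝓘(ℝ, B.model) ∞ (anMap B A ψ))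
    {ι : Type} {s : ℕ} (V : SmoothComplexVectorBundle ι B.model B.carrier s) (D : V.Connection) :
    A.chernCharacter (V.pullback (anMap B A ψ) hf) p = r • complexBetti.map ψ (2 * p) (B.chernCharacter V p) := by
  have h1 : (V.pullback (anMap B A ψ) hf).chernCharacterDeRham p =
      complexDeRhamCohomology.map A.model hf (2 * p) (V.chernCharacterDeRham p) :=
    SmoothComplexVectorBundle.chernCharacterDeRham_pullback
      (SmoothComplexVectorBundle.exists_isChernCharacterForm_holds B.model B.carrier)
      (SmoothComplexVectorBundle.mk_eq_mk_of_isChernCharacterForm_holds B.model B.carrier)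
      (SmoothComplexVectorBundle.mk_eq_mk_of_isChernCharacterForm_holds A.model A.carrier) D hf p
  apply A.pullback_injective (2 * p)
  rw [A.pullback_chernCharacter_eq, h1, hr, map_smul, pullback_map_chernCharacter_eq_inducedIso]

/-- **Functoriality of `ch₁(𝒪(-1))` along an arbitrary `ψ : T ⟶ ℙᴺ`, up to ONE non-zero scalar
independent of `ψ`.** For a smooth projective `n`-fold `T` with Hodge model `A`, a Hodge model `B`
of `ℙᴺ` and `n ≤ N`, there is `r ≠ 0` in `ℂ` such that for every morphism `ψ : T ⟶ ℙᴺ` the first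
Chern character, computed on `A`, of the cocycle `(ψ^an)⁻¹V` induced from the tautological cocycle
`V = 𝒪(-1)` of `ℙᴺ` (read on `B`) is `r • ψ^* ch₁ᴮ(V)` in `H²(T(ℂ); ℂ)` (Kobayashi, Ch. II §1 Axiom 2,
"`c(f⁻¹E) = f^*(c(E))`"; the scalar compares the normalisations `A.deRham` and `B.deRham` of the two
Hodge models through the cylinder and the rigidity of natural comparisons, module docstring).
[cite: Kobayashi1987, Ch. II §1 Axiom 2 and §2 Thm. 2.16] [cite: VoisinHodgeI2002, §7.3.2 and §11.2] -/
theorem exists_chernCharacter_tautologicalBundle_pullback_eq_smul_map :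
    ∀ ⦃n N : ℕ⦄ ⦃T : Motives.SchemeOver ℂ⦄ (hT : Motives.IsSmoothProjective n T) (A : HodgeModel n T)
      (B : HodgeModel N (Motives.projectiveSpace N ℂ))
      [IsClosedImmersion (𝟙 (Motives.projectiveSpace N ℂ) : Motives.projectiveSpace N ℂ ⟶ _).left], n ≤ N →
      ∃ r : ℂ, r ≠ 0 ∧ ∀ ψ : T ⟶ Motives.projectiveSpace N ℂ,
        A.chernCharacter
          ((Motives.AnalytificationKaehler.tautologicalBundle (𝟙 (Motives.projectiveSpace N ℂ)) B.isAnalytification).pullback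
            (HodgeModel.anMap B A ψ)
            (HodgeModel.contMDiff_anMap B A ψ hT (isSmoothProjective_projectiveSpace' N))) 1 =
        r • complexBetti.map ψ (2 * 1)
          (B.chernCharacter
            (Motives.AnalytificationKaehler.tautologicalBundle (𝟙 (Motives.projectiveSpace N ℂ)) B.isAnalytification) 1) := by
  intro n N T hT A B _ hnN
  obtain ⟨r, hr0, hr⟩ := exists_ne_zero_deRham_eq_smul_inducedIso hT A B hnN (2 * 1)
  exact ⟨r, hr0, fun ψ ↦ chernCharacter_pullback_eq_smul_map_of_deRham_eq_smul A B hnN hr ψ _ _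
    (Motives.AnalytificationKaehler.tautologicalConnection (𝟙 (Motives.projectiveSpace N ℂ)) B.isAnalytification)⟩

end HodgeModel

end HodgeTheory

end Literature.AlgebraicGeometry.HodgeTheory

end
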